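import Summits.FinalStateConjecture.FinalStateConjecture.Statement
import Literature.Geometry.Lorentzian.MinkowskiCauchyDevelopment
import Literature.Geometry.Lorentzian.CauchyDevelopmentRestrict
import Literature.Geometry.Lorentzian.OpensCausality
import Literature.Geometry.Lorentzian.OpensChartGeodesic
import Literature.Geometry.Lorentzian.CauchyProblemProofs

/-!
# Time-truncated Minkowski space: a vacuum Cauchy development of the trivial data with
# INCOMPLETE future null infinity (sojourn form) — negative-side support for the crux
# `WeakCosmicCensorshipMGHD` (item `stmt-FinalStateConjecture-9952`, route PhaseMixingCapture)

The crux asserts, Christodoulou-generically, that every MAXIMAL vacuum Cauchy development has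
complete `𝓘⁺` in the sojourn sense (`Summit.FinalStateConjecture.HasCompleteNullInfinity`). This
file proves that the restriction to maximal developments is load-bearing already at the trivial
datum: the open sub-spacetime `{x⁰ < 1}` of Minkowski space is a vacuum Cauchy development of
`(ℝ³, δ, 0)` (`truncated`, built with the tree's `VacuumCauchyDevelopment.restrict`;
the slice `{x⁰ = 0}` is still a Cauchy hypersurface of it, `isCauchyHypersurface_futureCut`) whose
future null infinity is NOT complete (`not_hasCompleteNullInfinity_truncated`): every
normalised future null ray `t ↦ (t, y + t e)` from the slice is a maximal null geodesic of the
truncated spacetime with affine domain `(-∞, 1)`, bounded above, and sojourn time `≤ 1` in any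
set whatsoever, while rays start arbitrarily far out. This is the "time-truncated Minkowski ✗"
entry of the test table of `NullInfinity.lean`, for the first time as a theorem and over the
repaired carrier `VacuumCauchyDevelopment`.

All results proved; no named facts.

## References

* D. Christodoulou, CQG 16 (1999) A23, pp. A26–A27 (complete future null infinity).
* M. Dafermos, I. Rodnianski, arXiv:0811.0354, §2.6.2.
* B. O'Neill, *Semi-Riemannian geometry*, 1983, Ch. 3, Example 25 (geodesics of `ℝⁿ₁` are lines),
  Ch. 14, Def. 14.28 (Cauchy hypersurfaces).
-/

noncomputable section

open Bundle Set Function Filter TopologicalSpace Topology MeasureTheory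
open scoped Manifold ContDiff Topology ENNReal

namespace Summit.FinalStateConjecture.FinalStateConjecture.Theorems.WeakCosmicCensorshipMGHD.Negative

open Literature.Geometry.Lorentzian Literature.Geometry.Lorentzian.Minkowski

/-! ### The future cut `{x⁰ < 1}` -/

/-- The open half-space `{x⁰ < 1}` of `E4`. -/
def futureCut : Opens E4 :=
  ⟨{x : E4 | x 0 < 1}, isOpen_lt (EuclideanSpace.proj (0 : Fin 4)).continuous continuous_const⟩

/-- Membership in the cut is `x⁰ < 1`. -/
@[simp] theorem mem_futureCut {x : E4} : x ∈ futureCut ↔ x 0 < 1 := Iff.rfl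

/-- The cut is a half-space, hence convex. -/
theorem convex_futureCut : Convex ℝ (futureCut : Set E4) :=
  convex_halfSpace_lt (EuclideanSpace.proj (0 : Fin 4)).isLinear 1

/-- The cut is connected (convex and nonempty). -/
theorem isConnected_futureCut : IsConnected (futureCut : Set E4) :=
  (convex_futureCut.isPathConnected ⟨0, by simp⟩).isConnected

/-- The slice `{x⁰ = 0}` lies in the cut. -/
theorem sliceEmbed_mem_futureCut (y : slice) : sliceEmbed y ∈ futureCut := by
  simp [sliceEmbed_apply]

/-- The slice embedding, the unit normal `∂ₜ` along it, as a differentiable map into `T E4`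
(hypothesis `hν` of `VacuumCauchyDevelopment.restrict`). -/
theorem mdifferentiableAt_sliceNormal (y : slice) :
    MDifferentiableAt (𝓡 3) (𝓡 4).tangent
      (fun x ↦ (TotalSpace.mk' E4 (vacuumCauchyDevelopment.embed x)
        (vacuumCauchyDevelopment.normal x) : TangentBundle (𝓡 4) E4)) y := by
  refine (mdifferentiableAt_totalSpace (𝓡 4) _).2 ⟨?_, ?_⟩
  · exact (isSmoothEmbedding_sliceEmbed_holds.contMDiff y).mdifferentiableAt (by simp)
  · simp only [trivializationAt_model_space_apply]
    exact mdifferentiableAt_const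

/-! ### The slice is a Cauchy hypersurface of the future cut -/

/-- Along a future timelike curve of Minkowski spacetime on an interval whose time coordinate is
bounded above on the domain, the curve has a future endpoint whose time coordinate is at most the
bound (monotone bounded time converges, the spatial part is Cauchy: `norm_spatial_sub_le`). -/
theorem exists_hasFutureEndpoint_of_time_le {γ : ℝ → E4} {s : Set ℝ} (hs : s.OrdConnected)
    (hne : s.Nonempty)
    (h : spacetime.metric.IsFutureTimelikeCurveOn spacetime.timeOrientation γ s) {T₀ : ℝ}
    (hT₀ : ∀ σ ∈ s, γ σ 0 ≤ T₀) :
    ∃ p : E4, p 0 ≤ T₀ ∧ HasFutureEndpoint γ s p := by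
  haveI : Nonempty s := hne.to_subtype
  have hmono : Monotone fun σ : s ↦ γ σ 0 :=
    monotoneOn_iff_monotone.mp (strictMonoOn_time hs h).monotoneOn
  have hb' : BddAbove (range fun σ : s ↦ γ σ 0) := ⟨T₀, by rintro _ ⟨σ, rfl⟩; exact hT₀ σ σ.2⟩
  obtain ⟨⟨T, hT⟩, q, hq⟩ := tendsto_of_monotone_of_dist_le hmono hb'
    (fun i j hij ↦ by
      rw [dist_eq_norm]
      exact norm_spatial_sub_le hs h i.2 j.2 hij)
  refine ⟨E4.ofTimeSpace T q, ?_, tendsto_of_tendsto_time_spatial hT hq⟩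
  rw [E4.ofTimeSpace_apply_zero]
  exact le_of_tendsto' hT fun σ ↦ hT₀ σ σ.2

/-- A past endpoint of a future timelike curve has time coordinate at most any value of the time
coordinate along the curve. -/
theorem apply_zero_le_of_hasPastEndpoint {γ : ℝ → E4} {s : Set ℝ} (hs : s.OrdConnected)
    (h : spacetime.metric.IsFutureTimelikeCurveOn spacetime.timeOrientation γ s) {p : E4}
    (hp : HasPastEndpoint γ s p) {σ : ℝ} (hσ : σ ∈ s) : p 0 ≤ γ σ 0 := by
  haveI : Nonempty s := ⟨⟨σ, hσ⟩⟩
  have hT : Tendsto (fun t : s ↦ γ t 0) atBot (𝓝 (p 0)) :=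
    ((EuclideanSpace.proj (0 : Fin 4)).continuous.tendsto p).comp hp
  refine le_of_tendsto hT ?_
  filter_upwards [eventually_le_atBot (⟨σ, hσ⟩ : s)] with t ht
  exact (strictMonoOn_time hs h).monotoneOn t.2 hσ ht

/-- **The slice `{x⁰ = 0}` is a Cauchy hypersurface of the open sub-spacetime `{x⁰ < 1}` of
Minkowski space.** Along an endless timelike curve of the cut the time coordinate is strictly
increasing and continuous; it is unbounded below (a past endpoint in `E4` would have time `< 1`,
hence lie in the cut) and takes positive values (else the curve would converge in `E4` to a point
of time `≤ 0 < 1`, a future endpoint in the cut); so it vanishes exactly once. O'Neill 1983,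
Ch. 14, Def. 14.28. -/
theorem isCauchyHypersurface_futureCut :
    (vacuumCauchyDevelopment.metric.restrict PseudoRiemannianMetric.contMDiff_restrict_holds
        futureCut).IsCauchyHypersurface
      (vacuumCauchyDevelopment.timeOrientation.restrict PseudoRiemannianMetric.contMDiff_restrict_holds
        vacuumCauchyDevelopment.timeOrientation.contMDiff_restrict_holds futureCut)
      (range (vacuumCauchyDevelopment.embedOpens futureCut sliceEmbed_mem_futureCut)) := by
  intro γ s hγ
  obtain ⟨hs, htl, hfut, hpast⟩ := hγ
  have h : spacetime.metric.IsFutureTimelikeCurveOn spacetime.timeOrientation (Subtype.val ∘ γ) s :=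
    (LorentzianMetric.isFutureTimelikeCurveOn_restrict_iff _ _ _ _ _).1 htl
  set c : ℝ → E4 := Subtype.val ∘ γ with hc
  have hmono := strictMonoOn_time hs h
  -- the ambient curve is past endless
  have hpastE : IsPastEndless c s := by
    refine ⟨hpast.1, fun p hp ↦ ?_⟩
    obtain ⟨σ, hσ⟩ := hpast.1
    have hp0 : p 0 < 1 := lt_of_le_of_lt (apply_zero_le_of_hasPastEndpoint hs h hp hσ) (γ σ).2
    exact hpast.2 ⟨p, hp0⟩ ((hasPastEndpoint_subtypeVal_comp_iff (p := ⟨p, hp0⟩)).1 hp)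
  obtain ⟨a, ha, ha0⟩ : ∃ a ∈ s, c a 0 < 0 := by
    obtain ⟨_, ⟨a, ha, rfl⟩, hlt⟩ := not_bddBelow_iff.mp (not_bddBelow_time hs h hpastE) 0
    exact ⟨a, ha, hlt⟩
  -- some value of the time coordinate is positive
  obtain ⟨b, hb, hb0⟩ : ∃ b ∈ s, 0 < c b 0 := by
    by_contra hcon
    push Not at hcon
    obtain ⟨p, hp0, hp⟩ := exists_hasFutureEndpoint_of_time_le hs hfut.1 h hcon
    have hp1 : p 0 < 1 := by linarith
    exact hfut.2 ⟨p, hp1⟩ ((hasFutureEndpoint_subtypeVal_comp_iff (p := ⟨p, hp1⟩)).1 hp)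
  obtain ⟨σ, hσ, hσ0⟩ : ∃ σ ∈ s, c σ 0 = 0 :=
    hs.isPreconnected.intermediate_value ha hb (continuousOn_time h) ⟨ha0.le, hb0.le⟩
  obtain ⟨y, hy⟩ := (E4.mem_range_sliceEmbed_iff (c σ)).2 hσ0
  refine ⟨σ, ⟨hσ, ⟨y, Subtype.ext hy⟩⟩, ?_⟩
  rintro t ⟨ht, ⟨y', hy'⟩⟩
  have ht0 : c t 0 = 0 := (E4.mem_range_sliceEmbed_iff (c t)).1 ⟨y', congrArg Subtype.val hy'⟩
  exact hmono.injOn ht hσ (ht0.trans hσ0.symm)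

/-- **Time-truncated Minkowski space `{x⁰ < 1}` as a vacuum Cauchy development of the trivial
data `(ℝ³, δ, 0)`**: the restriction of `Minkowski.vacuumCauchyDevelopment` to the open connected
sub-spacetime `futureCut ⊇ {x⁰ = 0}`, in which the slice is still a Cauchy hypersurface. It embeds
into Minkowski space (`VacuumCauchyDevelopment.restrict_embedsInto`) and is not maximal. -/
def truncated : VacuumCauchyDevelopment trivialData :=
  vacuumCauchyDevelopment.restrict futureCut isConnected_futureCut sliceEmbed_mem_futureCut
    mdifferentiableAt_sliceNormal isCauchyHypersurface_futureCut


/-! ### The fields of the truncated development -/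

/-- The metric of the cut: `η` restricted to `{x⁰ < 1}`. -/
abbrev cutMetric : LorentzianMetric (𝓡 4) ∞ futureCut :=
  vacuumCauchyDevelopment.metric.restrict PseudoRiemannianMetric.contMDiff_restrict_holds futureCut

/-- The time orientation of the cut: `∂ₜ` restricted. -/
abbrev cutOrientation : TimeOrientation cutMetric :=
  vacuumCauchyDevelopment.timeOrientation.restrict PseudoRiemannianMetric.contMDiff_restrict_holds
    vacuumCauchyDevelopment.timeOrientation.contMDiff_restrict_holds futureCut

/-- The metric of the truncated development is the restricted `η` (by `rfl`). -/
theorem truncated_metric : truncated.metric = cutMetric := rfl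

/-- The time orientation of the truncated development is the restricted `∂ₜ` (by `rfl`). -/
theorem truncated_timeOrientation : truncated.timeOrientation = cutOrientation := rfl

/-- The embedding of the truncated development is the codomain-restricted slice embedding (by `rfl`). -/
theorem truncated_embed :
    truncated.embed = vacuumCauchyDevelopment.embedOpens futureCut sliceEmbed_mem_futureCut := rfl

/-- The normal of the truncated development is `∂ₜ` (by `rfl`). -/
theorem truncated_normal : truncated.normal = fun y ↦ sliceNormal y := rfl

/-- The components of the restricted metric are the constant form `η`. -/
@[simp] theorem cutMetric_val (x : futureCut) : cutMetric.val x = bilin := rfl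

/-- The orienting field of the cut is `∂ₜ`. -/
@[simp] theorem cutOrientation_vectorField (x : futureCut) :
    cutOrientation.vectorField x = E4.basisVector 0 := rfl

/-! ### The outgoing null rays `t ↦ (t, y + t e)` of the cut -/

/-- A unit vector of `E3`. -/
def dirE3 : E3 := EuclideanSpace.single 0 1

/-- `e` is a unit vector. -/
@[simp] theorem norm_dirE3 : ‖dirE3‖ = 1 := by simp [dirE3]

/-- The null direction `v = (1, e)`. -/
def nullDir : E4 := E4.ofTimeSpace 1 dirE3

/-- The time component of `v` is `1`. -/
@[simp] theorem nullDir_apply_zero : nullDir 0 = 1 := by simp [nullDir]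

/-- `v ≠ 0`. -/
theorem nullDir_ne_zero : nullDir ≠ 0 := fun h ↦ by simpa using congrArg (fun v : E4 ↦ v 0) h

/-- `η(v, v) = -1 + ‖e‖² = 0`. -/
theorem bilin_nullDir : bilin nullDir nullDir = 0 := by
  simp [nullDir, dirE3, E4.ofTimeSpace_apply_succ]

/-- `η(∂ₜ, v) = -1`. -/
theorem bilin_basisVector_nullDir : bilin (E4.basisVector 0) nullDir = -1 := by
  rw [bilin_basisVector_zero_left, nullDir_apply_zero]

/-- The cut-off affine parameter: `t` before time `1`, and `0` (a junk value inside the cut) after. -/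
def θ (t : ℝ) : ℝ := if t < 1 then t else 0

/-- Before time `1` the cut-off parameter is the parameter. -/
theorem θ_of_lt {t : ℝ} (h : t < 1) : θ t = t := if_pos h

/-- The cut-off parameter is always `< 1`. -/
theorem θ_lt_one (t : ℝ) : θ t < 1 := by
  unfold θ; split_ifs with h
  · exact h
  · exact one_pos

/-- Coordinate expression of the ray from `y`: `(0, y) + θ(t) v`. -/
def rayCoord (y : slice) (t : ℝ) : E4 := sliceEmbed y + θ t • nullDir

/-- The time coordinate along the ray is the cut-off parameter. -/
theorem rayCoord_apply_zero (y : slice) (t : ℝ) : rayCoord y t 0 = θ t := by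
  simp [rayCoord, sliceEmbed_apply]

/-- The ray stays in the cut. -/
theorem rayCoord_mem (y : slice) (t : ℝ) : rayCoord y t ∈ futureCut := by
  rw [mem_futureCut, rayCoord_apply_zero]
  exact θ_lt_one t

/-- The ray from `y` as a curve in the cut (all of `ℝ` is mapped into the cut; the geodesic
parameter domain is `(-∞, 1)`). -/
def ray (y : slice) (t : ℝ) : futureCut := ⟨rayCoord y t, rayCoord_mem y t⟩

/-- Near a parameter `t < 1` the ray is the affine null line `s ↦ (0, y) + s v`. -/
theorem rayCoord_eventuallyEq (y : slice) {t : ℝ} (ht : t < 1) :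
    rayCoord y =ᶠ[𝓝 t] fun s ↦ sliceEmbed y + s • nullDir := by
  filter_upwards [Iio_mem_nhds ht] with s hs
  rw [rayCoord, θ_of_lt hs]

/-- Before time `1` the ray has derivative `v`. -/
theorem hasDerivAt_rayCoord (y : slice) {t : ℝ} (ht : t < 1) :
    HasDerivAt (rayCoord y) nullDir t := by
  have h : HasDerivAt (fun s : ℝ ↦ sliceEmbed y + s • nullDir) nullDir t := by
    simpa using ((hasDerivAt_id t).smul_const nullDir).const_add (sliceEmbed y)
  exact h.congr_of_eventuallyEq (rayCoord_eventuallyEq y ht)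

/-- The ray starts at `ι y`. -/
theorem ray_zero (y : slice) :
    ray y 0 = vacuumCauchyDevelopment.embedOpens futureCut sliceEmbed_mem_futureCut y := by
  apply Subtype.ext
  change rayCoord y 0 = sliceEmbed y
  simp [rayCoord, θ_of_lt one_pos]

/-- The Christoffel map of the constant components `η` vanishes. -/
theorem christoffel_cut_eq_zero [cutMetric.toPseudoRiemannianMetric.HasLeviCivita]
    (x : futureCut) (Y X : E4) :
    OpensChart.christoffel cutMetric.toPseudoRiemannianMetric (fun _ : E4 ↦ bilin) x Y X = 0 := by
  have hK : OpensChart.koszulForm (fun _ : E4 ↦ bilin) (x : E4) Y X = 0 := by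
    ext Z
    simp [OpensChart.koszulForm_apply]
  rw [OpensChart.christoffel_apply, hK, smul_zero]
  exact map_zero _

/-- **The rays are null geodesics of the cut**, with velocity `v`, on the parameter set
`(-∞, 1)` (straight lines; O'Neill 1983, Ch. 3, Example 25, via
`OpensChart.isGeodesicOn_of_hasDerivAt`). -/
theorem isGeodesicOn_ray [cutMetric.toPseudoRiemannianMetric.HasLeviCivita] (y : slice) :
    IsGeodesicOn cutMetric.toPseudoRiemannianMetric.leviCivita (ray y) (Iio 1) ∧
      ∀ t ∈ Iio 1, velocity 𝓘(ℝ, E4) (ray y) t = nullDir :=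
  OpensChart.isGeodesicOn_of_hasDerivAt (g := cutMetric.toPseudoRiemannianMetric)
    (G := fun _ : E4 ↦ bilin) (fun _ ↦ rfl) (fun _ ↦ differentiableAt_const _) isOpen_Iio
    (c := rayCoord y) (c' := fun _ ↦ nullDir) (c'' := fun _ ↦ 0) (fun _ ↦ rfl)
    (fun t ht ↦ hasDerivAt_rayCoord y ht) (fun t _ ↦ hasDerivAt_const t nullDir)
    (fun t _ ↦ by rw [christoffel_cut_eq_zero, add_zero])

/-- **The rays are MAXIMAL geodesics of the cut on `(-∞, 1)`**: a geodesic extension to an open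
interval `s' ⊋ (-∞, 1)` would be continuous at `1` with value in the cut, whereas the ray tends,
in `E4`, to the point `(0, y) + v` of time `1`, outside the cut. -/
theorem isMaximalGeodesicOn_ray [cutMetric.toPseudoRiemannianMetric.HasLeviCivita] (y : slice) :
    IsMaximalGeodesicOn cutMetric.toPseudoRiemannianMetric.leviCivita (ray y) (Iio 1) := by
  refine ⟨isOpen_Iio, ordConnected_Iio, (isGeodesicOn_ray y).1, fun γ' s' hs' hsc' hsub hγ' heq ↦ ?_⟩
  by_contra hne
  -- some parameter `≥ 1` lies in `s'`, hence `1 ∈ s'`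
  obtain ⟨t', ht', ht'1⟩ : ∃ t' ∈ s', 1 ≤ t' := by
    by_contra hcon
    push Not at hcon
    exact hne (Subset.antisymm (fun t ht ↦ hcon t ht) hsub)
  have h1 : (1 : ℝ) ∈ s' := hsc'.out (hsub (show (0 : ℝ) ∈ Iio 1 by norm_num)) ht' ⟨zero_le_one, ht'1⟩
  -- `γ'` is continuous at `1`
  have hcont : ContinuousAt (fun t ↦ ((γ' t : futureCut) : E4)) 1 := by
    have hL := (hγ'.1 1 h1).continuousAt
    have hp : Continuous (TotalSpace.proj : TangentBundle 𝓘(ℝ, E4) futureCut → futureCut) :=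
      FiberBundle.continuous_proj E4 (TangentSpace 𝓘(ℝ, E4))
    exact continuous_subtype_val.continuousAt.comp ((hp.continuousAt).comp hL)
  -- along `t ↑ 1` the curve is the ray, which tends to `(0, y) + v`
  have hlim1 : Tendsto (fun t ↦ ((γ' t : futureCut) : E4)) (𝓝[<] 1) (𝓝 ((γ' 1 : futureCut) : E4)) :=
    hcont.tendsto.mono_left nhdsWithin_le_nhds
  have hlim2 : Tendsto (fun t ↦ ((γ' t : futureCut) : E4)) (𝓝[<] 1)
      (𝓝 (sliceEmbed y + (1 : ℝ) • nullDir)) := by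
    have hline : Tendsto (fun s : ℝ ↦ sliceEmbed y + s • nullDir) (𝓝[<] 1)
        (𝓝 (sliceEmbed y + (1 : ℝ) • nullDir)) :=
      ((continuous_const.add (continuous_id.smul continuous_const)).tendsto 1).mono_left
        nhdsWithin_le_nhds
    refine hline.congr' ?_
    filter_upwards [self_mem_nhdsWithin] with t ht
    have := heq ht
    rw [← this]
    change sliceEmbed y + t • nullDir = rayCoord y t
    rw [rayCoord, θ_of_lt ht]
  have hval : ((γ' 1 : futureCut) : E4) = sliceEmbed y + (1 : ℝ) • nullDir :=
    tendsto_nhds_unique hlim1 hlim2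
  have hlt : (sliceEmbed y + (1 : ℝ) • nullDir) 0 < 1 := by rw [← hval]; exact (γ' 1).2
  simp [sliceEmbed_apply] at hlt

/-- **The rays are normalised future null rays of the truncated development** from the points of
the slice: maximal null geodesics with `γ 0 = ι y`, future-directed velocity `v`, `η(v, ∂ₜ) = -1`. -/
theorem isNormalisedNullRayFrom_ray [truncated.metric.HasLeviCivita] (y : slice) :
    truncated.metric.IsNormalisedNullRayFrom truncated.timeOrientation truncated.embed
      truncated.normal y (ray y) (Iio 1) := by
  haveI : cutMetric.toPseudoRiemannianMetric.HasLeviCivita := ‹truncated.metric.HasLeviCivita›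
  have hv : velocity 𝓘(ℝ, E4) (ray y) 0 = nullDir := (isGeodesicOn_ray y).2 0 (by norm_num)
  refine ⟨isMaximalGeodesicOn_ray y, by norm_num, ray_zero y, ?_, ?_, ?_⟩
  · change bilin (velocity 𝓘(ℝ, E4) (ray y) 0) (velocity 𝓘(ℝ, E4) (ray y) 0) = 0 ∧
      velocity 𝓘(ℝ, E4) (ray y) 0 ≠ 0
    rw [hv]
    exact ⟨bilin_nullDir, nullDir_ne_zero⟩
  · change (bilin (velocity 𝓘(ℝ, E4) (ray y) 0) (velocity 𝓘(ℝ, E4) (ray y) 0) ≤ 0 ∧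
        velocity 𝓘(ℝ, E4) (ray y) 0 ≠ 0) ∧
      bilin (E4.basisVector 0) (velocity 𝓘(ℝ, E4) (ray y) 0) < 0
    rw [hv, bilin_nullDir, bilin_basisVector_nullDir]
    exact ⟨⟨le_rfl, nullDir_ne_zero⟩, by norm_num⟩
  · change bilin (velocity 𝓘(ℝ, E4) (ray y) 0) (E4.basisVector 0) = -1
    rw [hv, bilin_symm, bilin_basisVector_nullDir]

/-! ### Incompleteness of future null infinity of the truncated development -/

/-- The slice `ℝ³` is not covered by any compact set: outside any compact `B ⊆ ℝ³` there is a
point of the slice. -/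
theorem exists_not_mem_of_isCompact {B : Set slice} (hB : IsCompact B) : ∃ y : slice, y ∉ B := by
  obtain ⟨R, hR⟩ := (Metric.isBounded_iff_subset_closedBall (0 : E3)).1
    (hB.image continuous_subtype_val).isBounded
  refine ⟨⟨(|R| + 1) • dirE3, mem_slice _⟩, fun hy ↦ ?_⟩
  have h := hR ⟨_, hy, rfl⟩
  rw [Metric.mem_closedBall, dist_zero_right, norm_smul, norm_dirE3, mul_one, Real.norm_eq_abs,
    abs_of_nonneg (by positivity)] at h
  linarith [le_abs_self R]

/-- **Time-truncated Minkowski space has INCOMPLETE future null infinity** (sojourn form): for any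
candidate `B₀` and the threshold `s = 2`, whatever compact `B₁` is exempted there is a slice point
`y ∉ B₁`, and the normalised null ray from `y` has affine domain `(-∞, 1)` — bounded above — and
sojourn time `≤ |[0, 1)| = 1 < 2` in any set. The "time-truncated Minkowski ✗" entry of the test
table of `NullInfinity.lean`, as a theorem over the repaired carrier. -/
theorem not_hasCompleteNullInfinity_truncated :
    ¬ _root_.Summit.FinalStateConjecture.HasCompleteNullInfinity truncated.toCauchyDevelopment := by
  intro h
  haveI hLC : truncated.metric.HasLeviCivita := truncated.metric.toPseudoRiemannianMetric.hasLeviCivita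
  have h' : truncated.metric.HasCompleteFutureNullInfinity truncated.timeOrientation truncated.embed
      truncated.normal := h
  obtain ⟨B₀, -, hB⟩ := h'
  obtain ⟨B₁, hB₁, hrays⟩ := hB 2 two_pos
  obtain ⟨y, hy⟩ := exists_not_mem_of_isCompact hB₁
  rcases hrays y hy (ray y) (Iio 1) (isNormalisedNullRayFrom_ray y) with hunb | hsoj
  · exact hunb bddAbove_Iio
  · have hle := hsoj.trans (sojournTime_le_volume (ray y) (Iio 1) _)
    rw [Iio_inter_Ici, Real.volume_Ico, sub_zero,
      ENNReal.ofReal_le_ofReal_iff zero_le_one] at hle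
    norm_num at hle

/-- **The trivial datum has a vacuum Cauchy development with incomplete `𝓘⁺`**: the property
"EVERY vacuum Cauchy development has complete future null infinity" — the crux's clause with the
maximality restriction dropped — fails at `(ℝ³, δ, 0)`. -/
theorem exists_vacuumCauchyDevelopment_trivialData_not_complete :
    ∃ 𝒟 : VacuumCauchyDevelopment trivialData,
      ¬ _root_.Summit.FinalStateConjecture.HasCompleteNullInfinity 𝒟.toCauchyDevelopment :=
  ⟨truncated, not_hasCompleteNullInfinity_truncated⟩

/-- The truncated development embeds into Minkowski space (it is a proper open sub-development). -/
theorem truncated_embedsInto :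
    truncated.toCauchyDevelopment.EmbedsInto vacuumCauchyDevelopment.toCauchyDevelopment :=
  vacuumCauchyDevelopment.restrict_embedsInto futureCut isConnected_futureCut sliceEmbed_mem_futureCut
    mdifferentiableAt_sliceNormal isCauchyHypersurface_futureCut

end Summit.FinalStateConjecture.FinalStateConjecture.Theorems.WeakCosmicCensorshipMGHD.Negative

end
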